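import Summits.CriticalPhenomena.PercolationContinuityZ3.Theses.PercShatteringRace

/-!
# Triage r2 (triager 2) scratch checks for card `worlds-split-density-sampling`

Vocabulary copied verbatim from `Cruxes/NearLinearTwoClusterDecay/SketchIdeator4R2.lean`
(namespace `…WorldsSplitR2`).  Checks:
1. `cruxUnfolds` — the card's `CruxUnfolds` (stated there as a bare `def : Prop`) HOLDS.
2. `jumpPairDecay_of_cruxJumpWorld` — S1 is implied by the jump half `U′` (S1 is necessary).
3. `cruxKillsThinStrands_trivial` — the card's advertised disprover lemma `CruxKillsThinStrands`
   is a TAUTOLOGY: its displayed event is literally the crux event `twoCluster n (outer n)`.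
-/

namespace TriageR2K2

open MeasureTheory Filter Topology
open Literature.Probability.LatticeModels Literature.Probability.Percolation
open Summit.CriticalPhenomena.PercolationContinuityZ3.Theses.PercShatteringRace

noncomputable section

abbrev Pc : Measure (BondConfig (Site 3)) := bondPercolation (zdGraph 3) (criticalProbI 3)

abbrev thetaC : ℝ := theta (zdGraph 3) 0 (criticalProbI 3)

def outer (n : ℕ) : ℕ := ⌈(n : ℝ) ^ ((7 : ℝ) / 6)⌉₊

def reachesOut (m : ℕ) (x : Site 3) : Set (BondConfig (Site 3)) :=
  {ω | ∃ y ∈ innerBoundary (zdGraph 3) (box 3 m), ω ∈ openConnIn ↑(box 3 m) x y}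

def pairBad (m : ℕ) (x x' : Site 3) : Set (BondConfig (Site 3)) :=
  reachesOut m x ∩ reachesOut m x' ∩ (openConnIn ↑(box 3 m) x x')ᶜ

def twoCluster (n m : ℕ) : Set (BondConfig (Site 3)) :=
  {ω | ∃ x ∈ box 3 n, ∃ x' ∈ box 3 n, ω ∈ pairBad m x x'}

def JumpPairDecay : Prop :=
  0 < thetaC → ∀ ε : ℝ, 0 < ε → ∀ᶠ n : ℕ in atTop,
    ∀ x ∈ box 3 n, ∀ x' ∈ box 3 n, Pc.real (pairBad (outer n) x x') ≤ ε

def CruxJumpWorld : Prop := 0 < thetaC → NearLinearTwoClusterDecay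

def CruxKillsThinStrands : Prop :=
  NearLinearTwoClusterDecay → 0 < thetaC →
    Tendsto (fun n : ℕ => Pc.real {ω | ∃ x ∈ box 3 n, ∃ x' ∈ box 3 n,
      ω ∈ reachesOut (outer n) x ∧ ω ∈ reachesOut (outer n) x' ∧
        ω ∉ openConnIn ↑(box 3 (outer n)) x x'})
      atTop (𝓝 0)

/-- The crux event written out equals `twoCluster n m`. -/
theorem twoCluster_eq (n m : ℕ) :
    twoCluster n m = {ω | ∃ x ∈ box 3 n, ∃ x' ∈ box 3 n,
      ∃ y ∈ innerBoundary (zdGraph 3) (box 3 m), ∃ y' ∈ innerBoundary (zdGraph 3) (box 3 m),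
        ω ∈ openConnIn ↑(box 3 m) x y ∧ ω ∈ openConnIn ↑(box 3 m) x' y' ∧
          ω ∉ openConnIn ↑(box 3 m) x x'} := by
  ext ω
  simp only [twoCluster, pairBad, reachesOut, Set.mem_setOf_eq, Set.mem_inter_iff,
    Set.mem_compl_iff]
  constructor
  · rintro ⟨x, hx, x', hx', ⟨⟨y, hy, hxy⟩, ⟨y', hy', hxy'⟩⟩, hn⟩
    exact ⟨x, hx, x', hx', y, hy, y', hy', hxy, hxy', hn⟩
  · rintro ⟨x, hx, x', hx', y, hy, y', hy', hxy, hxy', hn⟩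
    exact ⟨x, hx, x', hx', ⟨⟨y, hy, hxy⟩, ⟨y', hy', hxy'⟩⟩, hn⟩

/-- Check 1: the card's `CruxUnfolds` holds. -/
theorem cruxUnfolds :
    NearLinearTwoClusterDecay ↔ Tendsto (fun n : ℕ => Pc.real (twoCluster n (outer n))) atTop (𝓝 0) := by
  simp only [twoCluster_eq, NearLinearTwoClusterDecay, outer]

/-- Check 2: S1 (`JumpPairDecay`) is implied by the jump half of the crux. -/
theorem jumpPairDecay_of_cruxJumpWorld (h : CruxJumpWorld) : JumpPairDecay := by
  intro hθ ε hε
  have hT := cruxUnfolds.mp (h hθ)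
  have hev : ∀ᶠ n : ℕ in atTop, Pc.real (twoCluster n (outer n)) < ε := by
    have := (tendsto_order.1 hT).2 ε hε
    exact this
  filter_upwards [hev] with n hn x hx x' hx'
  refine le_trans ?_ hn.le
  refine measureReal_mono ?_
  intro ω hω
  exact ⟨x, hx, x', hx', hω⟩

/-- The event displayed in `CruxKillsThinStrands` is the crux event. -/
theorem thinStrandSet_eq (n : ℕ) :
    {ω | ∃ x ∈ box 3 n, ∃ x' ∈ box 3 n,
      ω ∈ reachesOut (outer n) x ∧ ω ∈ reachesOut (outer n) x' ∧
        ω ∉ openConnIn ↑(box 3 (outer n)) x x'} = twoCluster n (outer n) := by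
  ext ω
  simp only [twoCluster, pairBad, Set.mem_setOf_eq, Set.mem_inter_iff, Set.mem_compl_iff,
    and_assoc]

/-- Check 3: `CruxKillsThinStrands` is a tautology (`U → _ → U` after unfolding). -/
theorem cruxKillsThinStrands_trivial : CruxKillsThinStrands := by
  intro h _
  simp only [thinStrandSet_eq]
  exact cruxUnfolds.mp h

end

end TriageR2K2
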